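import Summits.ResolutionOfSingularities.ResolutionOfSingularities.Theorems.EquisingularLiftEquisingularLiftNatNoseResidueClassTwoRegular
import Summits.ResolutionOfSingularities.ResolutionOfSingularities.Theorems.EquisingularLiftEquisingularLiftNatNoseResidueUnfold
import HarnessLib

/-!
# [OURS · L1 W4.5(b) · EL♮(3)] NOSE RESIDUE STRUCTURE, brick 4 — the PROFILE of a residue `H ⊂ ℙ³_k` at EVERY candidate nose curve:
# the three-member core, unfolded at the curves of `H`, is a PERSISTENCE statement along smooth liftable curves

Cell `res-hironaka`, rung L, slot W4.5(b), D-0157 DOOR 1 width seat `res-L1-w45b-nose-w4` (desk WIDTH TABLE D1 row nose-w4, desk word (ii));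
crux CHILD EL♮(3) = stmt-ResolutionOfSingularities-20148 (parent EL♮ stmt-…-20038). OURS; NOT a statement of any manuscript; nothing of
[Hironaka2017] is asserted or used; AI kernel work, weaker than expert review. Resolution of singularities in positive characteristic is NOT proved here
(dimension 3 is a theorem in print, Cossart–Piltant 2008/2009). No `sorry`, no new definition, no instance, no notation; standard axioms.
`--kind proof --supports stmt-ResolutionOfSingularities-20148 --as helper`.  Sister files: `…NatNoseResidueUnfold` (1a), `…NatNoseResidueCore` (1b),
`…NatNoseResidueTopLocus` (2), `…NatNoseResidueClassTwoRegular` (3).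

THE PROFILE (`nose_residue_profile_three`).  Let `ι : H ↪ ℙ³_k` be a closed immersion of an integral NON-regular scheme (`k = k̄`) and assume the
three core negations of the residue, `¬ NoseHypLiftClassTwo`, `¬ ReachNoseTowerBDoublePrime`, `¬ ReachNoseTowerBTriplePrime` (bricks 1b: the other seven
negated hypotheses follow).  Then for EVERY closed irreducible infinite `Z ⊆ ι(H)` with `ι(H) ⊄ Z` (every curve on `H`, singular for `H` or not) that
belongs to the liftable nose class₂:
  (a) `Z̃ = redSub ℙ³ Z hZ` is a REGULAR scheme (brick 3) and a CURVE (`dim 𝒪_{Z̃,z} = 1` at closed points, brick 2) — i.e. `Z` meets every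
      nose-data clause of every nose engine of the chain;
  (b) for EVERY blow-up `υ : F₂ → ℙ³_k` of `Z`: the reduced strict transform `closure υ⁻¹(ι(H) ∖ Z)` is NOT regular (no one-step resolution), and
  (c) EVERY «then points» chain, EVERY B″-chain (`TowerPtRegB`/`TowerPtRamB`/`TowerRoundBDoublePrime`) and EVERY B‴-chain
      (`TowerPtRegB₄`/`TowerPtRamB₄`/`TowerRoundBTriplePrime`) started from `Bl_Z` ends with a NON-regular reduced strict transform.
So, read at the curves of `H`, the registered nose residue says: «along every smooth liftable-class curve of `H` the singularities PERSIST through all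
typed engines; and (brick 3 trichotomy) if no singular curve of `H` is of class₂ the residue is a curve-class / curve-singularity problem first».
Also recorded: `nose_residue_profile_singular_three` — the same profile at a SINGULAR CURVE of `H` produced by brick 2 (`exists_singularCurve_three`),
with the trichotomy (A)/(B1)/(B2) of brick 3 attached.  Typed ≠ proved beyond these statements.
-/

set_option linter.dupNamespace false

noncomputable section

open CategoryTheory CategoryTheory.Limits AlgebraicGeometry TopologicalSpace Topology IsLocalRing
open Literature.AlgebraicGeometry.Resolution
open Literature.AlgebraicGeometry.Motives
open AlgebraicGeometry.Scheme.IdealSheafData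
open Summit.ResolutionOfSingularities.ResolutionOfSingularities.Cruxes.EquisingularLift.StrataSplit

namespace Summit.ResolutionOfSingularities.ResolutionOfSingularities.Cruxes.EquisingularLiftNat.Sections

/-- **THE PROFILE OF A NOSE RESIDUE `H ⊂ ℙ³_k` AT A CLASS₂ CURVE.** See the module docstring: under the three core negations, every closed irreducible
infinite class₂ curve `Z ⊆ ι(H)`, `ι(H) ⊄ Z`, has a regular one-dimensional `Z̃`, and from ANY blow-up of `Z` neither the one-step strict transform nor any
«then points» / B″ / B‴ chain ends regular. [OURS · L1 W4.5b · pure logic over bricks 1a/1b/2/3] -/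
theorem nose_residue_profile_three (k : Type) [Field k] [IsAlgClosed k] (H : Scheme.{0}) (ι : H ⟶ (projectiveSpace 3 k).left)
    [IsClosedImmersion ι] [IsIntegral H] (hH : ¬ Literature.AlgebraicGeometry.Resolution.Scheme.IsRegular H)
    (hlc2 : ¬ NoseHypLiftClassTwo k 3 H ι) (hBPP : ¬ ReachNoseTowerBDoublePrime k 3 H ι) (hBT : ¬ ReachNoseTowerBTriplePrime k 3 H ι)
    (Z : Set (projectiveSpace 3 k).left) (hZ : IsClosed Z) (hZirr : IsIrreducible Z) (hZinf : Z.Infinite) (hZsub : Z ⊆ Set.range ι)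
    (hZne : ¬ (Set.range ι ⊆ Z)) (hcls : IsLiftableNoseClass₂ k 3 Z) :
    Literature.AlgebraicGeometry.Resolution.Scheme.IsRegular (redSub (projectiveSpace 3 k).left Z hZ) ∧
    (∀ z : ↥(redSub (projectiveSpace 3 k).left Z hZ), IsClosed ({z} : Set ↥(redSub (projectiveSpace 3 k).left Z hZ)) →
      ringKrullDim ((redSub (projectiveSpace 3 k).left Z hZ).presheaf.stalk z) = ((1 : ℕ) : WithBot ℕ∞)) ∧
    ∀ (F₂ : Scheme.{0}) (υ : F₂ ⟶ (projectiveSpace 3 k).left),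
      IsBlowup υ (vanishingIdeal (⟨Z, hZ⟩ : Closeds (projectiveSpace 3 k).left)) →
      -- (b) no one-step resolution
      ¬ Literature.AlgebraicGeometry.Resolution.Scheme.IsRegular
          (vanishingIdeal (⟨closure (υ ⁻¹' (Set.range ι \ Z)), isClosed_closure⟩ : Closeds F₂)).subscheme ∧
      -- (c1) every «then points» chain fails
      (∀ (F' : Scheme.{0}) (ρ' : F' ⟶ F₂) (T' : Set F'),
        (∀ Q : (∀ F₁ : Scheme.{0}, (F₁ ⟶ F₂) → Set F₁ → Prop),
          Q F₂ (𝟙 F₂) (closure (υ ⁻¹' (Set.range ι \ Z))) →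
          (∀ (F₁ F₃ : Scheme.{0}) (ρ : F₁ ⟶ F₂) (T₁ : Set F₁)
              (x : ↥(vanishingIdeal (⟨closure T₁, isClosed_closure⟩ : Closeds F₁)).subscheme) (υ₁ : F₃ ⟶ F₁)
              (hx : IsClosed ({((vanishingIdeal (⟨closure T₁, isClosed_closure⟩ : Closeds F₁)).subschemeι x : F₁)} : Set F₁)),
            Q F₁ ρ T₁ →
            ¬ IsRegularLocalRing ((vanishingIdeal (⟨closure T₁, isClosed_closure⟩ : Closeds F₁)).subscheme.presheaf.stalk x) →
            IsBlowup υ₁ (vanishingIdeal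
              (⟨{((vanishingIdeal (⟨closure T₁, isClosed_closure⟩ : Closeds F₁)).subschemeι x : F₁)}, hx⟩ : Closeds F₁)) →
            Q F₃ (υ₁ ≫ ρ) (closure (υ₁ ⁻¹' (T₁ \ {((vanishingIdeal (⟨closure T₁, isClosed_closure⟩ : Closeds F₁)).subschemeι x : F₁)})))) →
          Q F' ρ' T') →
        ¬ Literature.AlgebraicGeometry.Resolution.Scheme.IsRegular
            (vanishingIdeal (⟨closure T', isClosed_closure⟩ : Closeds F')).subscheme) ∧
      -- (c2) every B″-chain fails
      (∀ (F' : Scheme.{0}) (γ' : F' ⟶ F₂) (T' E' : Set F') (Es' : List (Set F')) (K' : Set F'),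
        (∀ R : (∀ G : Scheme.{0}, (G ⟶ F₂) → Set G → Set G → List (Set G) → Set G → Prop),
          R F₂ (𝟙 F₂) (closure (υ ⁻¹' (Set.range ι \ Z))) (υ ⁻¹' Z) [] ∅ →
          TowerPtRegB (projectiveSpace 3 k).left F₂ υ R →
          TowerPtRamB (projectiveSpace 3 k).left F₂ υ R →
          TowerRoundBDoublePrime (projectiveSpace 3 k).left F₂ υ Z hZ R →
          R F' γ' T' E' Es' K') →
        ¬ Literature.AlgebraicGeometry.Resolution.Scheme.IsRegular (redSub F' (closure T') isClosed_closure)) ∧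
      -- (c3) every B‴-chain fails
      (∀ (F' : Scheme.{0}) (γ' : F' ⟶ F₂) (T' E' : Set F') (Es' Ns' : List (Set F')) (K' : Set F'),
        (∀ R : (∀ G : Scheme.{0}, (G ⟶ F₂) → Set G → Set G → List (Set G) → List (Set G) → Set G → Prop),
          R F₂ (𝟙 F₂) (closure (υ ⁻¹' (Set.range ι \ Z))) (υ ⁻¹' Z) [] [] ∅ →
          TowerPtRegB₄ F₂ R →
          TowerPtRamB₄ F₂ R →
          TowerRoundBTriplePrime (projectiveSpace 3 k).left F₂ υ Z hZ R →
          R F' γ' T' E' Es' Ns' K') →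
        ¬ Literature.AlgebraicGeometry.Resolution.Scheme.IsRegular (redSub F' (closure T') isClosed_closure)) := by
  have hcurve := ringKrullDim_stalk_redSub_eq_one k H ι hH hZ hZirr hZinf hZsub hZne
  refine ⟨isRegular_redSub_of_isLiftableNoseClass₂ k 3 hcls hZ, hcurve, fun F₂ υ hυ => ⟨?_, ?_, ?_, ?_⟩⟩
  · exact not_isRegular_noseStrictTransform_of_not_noseHypLiftClassTwo k 3 H ι hlc2 Z hZ hcls hZsub hZne F₂ υ hυ
  · exact fun F' ρ' T' hcl => (not_noseHypLiftClassTwo_iff k 3 H ι).mp hlc2 Z hZ hcls hZsub hZne F₂ υ hυ F' ρ' T' hcl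
  · exact fun F' γ' T' E' Es' K' hcl =>
      (not_reachNoseTowerBDoublePrime_iff k 3 H ι).mp hBPP Z hZ hcls hZsub hZne hZinf hcurve F₂ υ hυ F' γ' T' E' Es' K' hcl
  · exact fun F' γ' T' E' Es' Ns' K' hcl =>
      (not_reachNoseTowerBTriplePrime_iff k 3 H ι).mp hBT Z hZ hcls hZsub hZne hZinf hcurve F₂ υ hυ F' γ' T' E' Es' Ns' K' hcl

/-- **THE PROFILE AT A SINGULAR CURVE** (existential form): under the three core negations a residue `H` (integral, `ι : H ↪ ℙ³_k` closed immersion, not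
regular, infinitely many non-regular points) has a singular curve `Z ⊆ ι(Sing H)` (closed, irreducible, infinite, `ι(H) ⊄ Z`, a curve at its closed points)
such that: IF `Z` is class₂ then `Z̃` is regular and from every blow-up of `Z` the one-step strict transform and every «then points» / B″ / B‴ chain end
NON-regular (`nose_residue_profile_three`); and IF `Z̃` is not regular then `Z` is in no nose class (brick 3). [OURS · L1 W4.5b · pure logic] -/
theorem nose_residue_profile_singular_three (k : Type) [Field k] [IsAlgClosed k] (H : Scheme.{0}) (ι : H ⟶ (projectiveSpace 3 k).left)
    [IsClosedImmersion ι] [IsIntegral H] (hH : ¬ Literature.AlgebraicGeometry.Resolution.Scheme.IsRegular H)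
    (hinf : ¬ Set.Finite {x : H | ¬ IsRegularLocalRing (H.presheaf.stalk x)})
    (hlc2 : ¬ NoseHypLiftClassTwo k 3 H ι) (hBPP : ¬ ReachNoseTowerBDoublePrime k 3 H ι) (hBT : ¬ ReachNoseTowerBTriplePrime k 3 H ι) :
    ∃ (Z : Set (projectiveSpace 3 k).left) (hZ : IsClosed Z), IsIrreducible Z ∧ Z.Infinite ∧
      Z ⊆ ι '' {x : H | ¬ IsRegularLocalRing (H.presheaf.stalk x)} ∧ Z ⊆ Set.range ι ∧ ¬ (Set.range ι ⊆ Z) ∧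
      (∀ z : ↥(redSub (projectiveSpace 3 k).left Z hZ), IsClosed ({z} : Set ↥(redSub (projectiveSpace 3 k).left Z hZ)) →
        ringKrullDim ((redSub (projectiveSpace 3 k).left Z hZ).presheaf.stalk z) = ((1 : ℕ) : WithBot ℕ∞)) ∧
      (¬ Literature.AlgebraicGeometry.Resolution.Scheme.IsRegular (redSub (projectiveSpace 3 k).left Z hZ) →
        ¬ IsLiftableNoseClass₂ k 3 Z ∧ ¬ IsLiftableNoseClass k 3 Z) ∧
      (IsLiftableNoseClass₂ k 3 Z →
        Literature.AlgebraicGeometry.Resolution.Scheme.IsRegular (redSub (projectiveSpace 3 k).left Z hZ) ∧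
        ∀ (F₂ : Scheme.{0}) (υ : F₂ ⟶ (projectiveSpace 3 k).left),
          IsBlowup υ (vanishingIdeal (⟨Z, hZ⟩ : Closeds (projectiveSpace 3 k).left)) →
          ¬ Literature.AlgebraicGeometry.Resolution.Scheme.IsRegular
              (vanishingIdeal (⟨closure (υ ⁻¹' (Set.range ι \ Z)), isClosed_closure⟩ : Closeds F₂)).subscheme ∧
          (∀ (F' : Scheme.{0}) (γ' : F' ⟶ F₂) (T' E' : Set F') (Es' : List (Set F')) (K' : Set F'),
            (∀ R : (∀ G : Scheme.{0}, (G ⟶ F₂) → Set G → Set G → List (Set G) → Set G → Prop),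
              R F₂ (𝟙 F₂) (closure (υ ⁻¹' (Set.range ι \ Z))) (υ ⁻¹' Z) [] ∅ →
              TowerPtRegB (projectiveSpace 3 k).left F₂ υ R →
              TowerPtRamB (projectiveSpace 3 k).left F₂ υ R →
              TowerRoundBDoublePrime (projectiveSpace 3 k).left F₂ υ Z hZ R →
              R F' γ' T' E' Es' K') →
            ¬ Literature.AlgebraicGeometry.Resolution.Scheme.IsRegular (redSub F' (closure T') isClosed_closure)) ∧
          (∀ (F' : Scheme.{0}) (γ' : F' ⟶ F₂) (T' E' : Set F') (Es' Ns' : List (Set F')) (K' : Set F'),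
            (∀ R : (∀ G : Scheme.{0}, (G ⟶ F₂) → Set G → Set G → List (Set G) → List (Set G) → Set G → Prop),
              R F₂ (𝟙 F₂) (closure (υ ⁻¹' (Set.range ι \ Z))) (υ ⁻¹' Z) [] [] ∅ →
              TowerPtRegB₄ F₂ R →
              TowerPtRamB₄ F₂ R →
              TowerRoundBTriplePrime (projectiveSpace 3 k).left F₂ υ Z hZ R →
              R F' γ' T' E' Es' Ns' K') →
            ¬ Literature.AlgebraicGeometry.Resolution.Scheme.IsRegular (redSub F' (closure T') isClosed_closure))) := by
  obtain ⟨Z, hZc, hZirr, hZinf, hZS, hZr, hZn, hcurve⟩ := exists_singularCurve_three k H ι hH hinf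
  refine ⟨Z, hZc, hZirr, hZinf, hZS, hZr, hZn, hcurve, fun hreg => not_isLiftableNoseClass₂_of_not_isRegular k 3 hZc hreg, fun hcls => ?_⟩
  obtain ⟨hreg, -, hprof⟩ := nose_residue_profile_three k H ι hH hlc2 hBPP hBT Z hZc hZirr hZinf hZr hZn hcls
  exact ⟨hreg, fun F₂ υ hυ =>
    ⟨(hprof F₂ υ hυ).1, (hprof F₂ υ hυ).2.2.1, (hprof F₂ υ hυ).2.2.2⟩⟩

end Summit.ResolutionOfSingularities.ResolutionOfSingularities.Cruxes.EquisingularLiftNat.Sections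

end
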